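import Literature.Algebra.Homology.OrderedCechPairSystemResolutionRows
import HarnessLib

/-!
# The comparison `Hⁿ(Tot Č•,•(P)) ≅ Hⁿ(q ↦ Q^q ∅ ∅)` from member-wise resolutions (Stacks 0BEC, 0133)

Layer `Literature/Algebra/Homology` (proved lemmas + one packaged isomorphism; 0 named facts, no instance, no notation; pure homological
algebra over a commutative ring `A`). Sequel to `Algebra/Homology/OrderedCechPairSystemResolution(Rows)`: for a resolution datum
`ε : P ⟶ Q⁰` of pair-systems of `A`-modules the row hypothesis (H1′) holds as soon as, MEMBER BY MEMBER on non-empty pairs `(s, t)`,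
`ε s t` is injective, `P s t → Q⁰ s t → Q¹ s t` is exact and `Q^{q-1} s t → Q^q s t → Q^{q+1} s t` is exact for `q ≥ 1` (elementwise;
the cochain modules `Čᵃ,ᵇ = Π_τ Π_σ` are finite products, and products of exact sequences of modules are exact — proved in place by
componentwise choice):

* `mono_sysBicomplexMap_f_f`, `exact_sysBicomplexMap_f_f`, `exactAt_row` — the three module-level conditions of
  `…ResolutionRows.quasiIso_colAugment_row` from the member-wise ones (`ModuleCat.mono_iff_injective`,
  `ShortComplex.moduleCat_exact_iff`);
* **`quasiIso_colAugment_row_of_memberwise`** — (H1′);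
* **`homologyIsoEmptyComplexOfMemberwise`** — the isomorphisms `Hⁿ(Tot Č•,•(P)) ≅ Hⁿ(q ↦ Q^q ∅ ∅)` under the member-wise resolution
  hypotheses, (H2col) and (H2∅) (all binders).

Everything is about abstract (complexes of) pair-systems; no scheme, sheaf or cohomology statement is made. Library only (cell
`pub-hodge-ring2`, count-neutral); proves nothing about any crux, route or conjecture. Mathlib searched (pin v4.32):
`ModuleCat.mono_iff_injective`, `ShortComplex.moduleCat_exact_iff`, `HomologicalComplex.exactAt_iff'` (used).

## References

* The Stacks Project, Tag 0BEC (Künneth: the double Čech complex), Tag 0133 (double complexes with exact rows). [StacksProject]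
* C. A. Weibel, *An introduction to homological algebra* (1994), 2.7.3, 5.6.2. [Weibel1994]
-/

universe u

open CategoryTheory CategoryTheory.Limits HomologicalComplex

set_option backward.isDefEq.respectTransparency false

noncomputable section

namespace Literature.Algebra.Homology

namespace OrderedCech

variable {A : Type u} [CommRing A] {ι κ : Type} [LinearOrder ι] [LinearOrder κ]
  {P : Finset ι ⥤ Finset κ ⥤ ModuleCat.{u} A} {Q : CochainComplex (Finset ι ⥤ Finset κ ⥤ ModuleCat.{u} A) ℤ}
  (ε : P ⟶ Q.X 0) (hε : ε ≫ Q.d 0 1 = 0)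

/-! ### §1 The module-level conditions from member-wise ones -/

/-- **`εᵃᵇ` is a monomorphism** when every member `ε s t` (`s`, `t` non-empty) is injective. [cite: StacksProject, Tag 0BEC] -/
theorem mono_sysBicomplexMap_f_f (a b : ℤ)
    (hinj : ∀ (s : Finset ι) (t : Finset κ), s.Nonempty → t.Nonempty → Function.Injective ((ε.app s).app t).hom) :
    Mono (((sysBicomplexMap ε).f a).f b) := by
  rw [ModuleCat.mono_iff_injective]
  intro x x' h
  funext τ σ
  apply hinj σ.1 τ.1 σ.2.1 τ.2.1
  have := congr_fun (congr_fun h τ) σ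
  rwa [sysBicomplexMap_f_f_apply, sysBicomplexMap_f_f_apply] at this

/-- **`Čᵃ,ᵇ(P) → Čᵃ,ᵇ(Q⁰) → Čᵃ,ᵇ(Q¹)` is exact** when every member `P s t → Q⁰ s t → Q¹ s t` is (elementwise), `s`, `t` non-empty.
[cite: StacksProject, Tag 0BEC] [cite: StacksProject, Tag 0133] -/
theorem exact_sysBicomplexMap_f_f (a b : ℤ)
    (hex : ∀ (s : Finset ι) (t : Finset κ), s.Nonempty → t.Nonempty → ∀ x : ((Q.X 0).obj s).obj t,
      (((Q.d 0 1).app s).app t).hom x = 0 → ∃ y : (P.obj s).obj t, ((ε.app s).app t).hom y = x) :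
    (ShortComplex.mk (((sysBicomplexMap ε).f a).f b) (((sysBicomplexMap (Q.d 0 1)).f a).f b)
      (eps_f_f_comp_d ε hε a b)).Exact := by
  rw [ShortComplex.moduleCat_exact_iff]
  intro x hx
  have hc : ∀ (τ : Simplex κ b) (σ : Simplex ι a),
      ∃ y : (P.obj σ.1).obj τ.1, ((ε.app σ.1).app τ.1).hom y = (x τ : SysCochain ((Q.X 0).flip.obj τ.1) a) σ := fun τ σ =>
    hex σ.1 τ.1 σ.2.1 τ.2.1 _ (by
      have := congr_fun (congr_fun hx τ) σ
      rwa [sysBicomplexMap_f_f_apply] at this)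
  choose y hy using hc
  refine ⟨fun τ σ => y τ σ, ?_⟩
  funext τ σ
  rw [sysBicomplexMap_f_f_apply]
  exact hy τ σ

/-- **The row complex `q ↦ Čᵃ,ᵇ(Q^q)` is exact in degree `q`** when every member complex `q ↦ Q^q s t` is (elementwise at `q`),
`s`, `t` non-empty. [cite: StacksProject, Tag 0133] -/
theorem exactAt_row (a b q : ℤ)
    (hex : ∀ (s : Finset ι) (t : Finset κ), s.Nonempty → t.Nonempty → ∀ x : ((Q.X q).obj s).obj t,
      (((Q.d q (q + 1)).app s).app t).hom x = 0 →
        ∃ y : ((Q.X (q - 1)).obj s).obj t, (((Q.d (q - 1) q).app s).app t).hom y = x) :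
    ((HomologicalComplex₂.flip ((cechTricomplex Q).flip.X a)).X b).ExactAt q := by
  rw [exactAt_iff' _ (q - 1) q (q + 1) (by simp) (by simp), ShortComplex.moduleCat_exact_iff]
  intro x hx
  have hc : ∀ (τ : Simplex κ b) (σ : Simplex ι a), ∃ y : ((Q.X (q - 1)).obj σ.1).obj τ.1,
      (((Q.d (q - 1) q).app σ.1).app τ.1).hom y = (x τ : SysCochain ((Q.X q).flip.obj τ.1) a) σ := fun τ σ =>
    hex σ.1 τ.1 σ.2.1 τ.2.1 _ (congr_fun (congr_fun hx τ) σ)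
  choose y hy using hc
  exact ⟨fun τ σ => y τ σ, funext fun τ => funext fun σ => hy τ σ⟩

/-! ### §2 (H1′) and the comparison from member-wise resolutions -/

/-- **(H1′) from member-wise resolutions**: every row of every `colAugment ε hε a` is a quasi-isomorphism when, member by member on
non-empty pairs, `ε s t` is injective, `P s t → Q⁰ s t → Q¹ s t` is exact and `q ↦ Q^q s t` is exact in degrees `≥ 1` (`Q` in
degrees `≥ 0`). [cite: StacksProject, Tag 0133] [cite: Weibel1994, 2.7.3] -/
theorem quasiIso_colAugment_row_of_memberwise [Q.IsStrictlyGE 0]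
    (hinj : ∀ (s : Finset ι) (t : Finset κ), s.Nonempty → t.Nonempty → Function.Injective ((ε.app s).app t).hom)
    (hex₀ : ∀ (s : Finset ι) (t : Finset κ), s.Nonempty → t.Nonempty → ∀ x : ((Q.X 0).obj s).obj t,
      (((Q.d 0 1).app s).app t).hom x = 0 → ∃ y : (P.obj s).obj t, ((ε.app s).app t).hom y = x)
    (hex : ∀ q : ℤ, 1 ≤ q → ∀ (s : Finset ι) (t : Finset κ), s.Nonempty → t.Nonempty → ∀ x : ((Q.X q).obj s).obj t,
      (((Q.d q (q + 1)).app s).app t).hom x = 0 →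
        ∃ y : ((Q.X (q - 1)).obj s).obj t, (((Q.d (q - 1) q).app s).app t).hom y = x)
    (a b : ℤ) :
    QuasiIso (((HomologicalComplex₂.flipFunctor _ (ComplexShape.up ℤ) (ComplexShape.up ℤ)).map
      (colAugment ε hε a)).f b) :=
  quasiIso_colAugment_row ε hε a b (mono_sysBicomplexMap_f_f ε a b hinj) (exact_sysBicomplexMap_f_f ε hε a b hex₀)
    fun q hq => exactAt_row a b q (hex q hq)

/-- **`Hⁿ(Tot Č•,•(P)) ≅ Hⁿ(q ↦ Q^q ∅ ∅)` from member-wise resolutions.** For a resolution datum `ε : P ⟶ Q⁰` (`Q` in degrees `≥ 0`)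
which, member by member on non-empty pairs, is injective with `P s t → Q⁰ s t → Q¹ s t` exact and `q ↦ Q^q s t` exact in degrees
`≥ 1`, and which satisfies (H2col) (every column of every `Č•,•(Q^q)` is Čech-resolved by its empty member) and (H2∅) (every
`Q^q(·, ∅)` is Čech-resolved by `Q^q ∅ ∅`), the total complex of the ordered Čech bicomplex of `P` and the corner complex have
canonically isomorphic cohomology (`homologyIsoEmptyComplex` with (H1′) discharged by `quasiIso_colAugment_row_of_memberwise`).
[cite: StacksProject, Tag 0BEC] [cite: StacksProject, Tag 0133] [cite: Weibel1994, 2.7.3] -/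
def homologyIsoEmptyComplexOfMemberwise [Q.IsStrictlyGE 0]
    (hinj : ∀ (s : Finset ι) (t : Finset κ), s.Nonempty → t.Nonempty → Function.Injective ((ε.app s).app t).hom)
    (hex₀ : ∀ (s : Finset ι) (t : Finset κ), s.Nonempty → t.Nonempty → ∀ x : ((Q.X 0).obj s).obj t,
      (((Q.d 0 1).app s).app t).hom x = 0 → ∃ y : (P.obj s).obj t, ((ε.app s).app t).hom y = x)
    (hex : ∀ q : ℤ, 1 ≤ q → ∀ (s : Finset ι) (t : Finset κ), s.Nonempty → t.Nonempty → ∀ x : ((Q.X q).obj s).obj t,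
      (((Q.d q (q + 1)).app s).app t).hom x = 0 →
        ∃ y : ((Q.X (q - 1)).obj s).obj t, (((Q.d (q - 1) q).app s).app t).hom y = x)
    (hcol : ∀ q a : ℤ, QuasiIso (sysAugmentHom (cochainSystem (Q.X q) a)))
    (hempty : ∀ q : ℤ, QuasiIso (sysAugmentHom ((Q.X q).flip.obj ∅))) (n : ℤ) :
    ((sysBicomplex P).total (ComplexShape.up ℤ)).homology n ≅ (emptyComplex Q).homology n :=
  homologyIsoEmptyComplex ε hε (quasiIso_colAugment_row_of_memberwise ε hε hinj hex₀ hex) hcol hempty n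

end OrderedCech

end Literature.Algebra.Homology

end
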